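import Literature.NumberTheory.Sieve.BombieriFriedlanderIwaniecDecomposition
import Literature.NumberTheory.Sieve.BombieriFriedlanderIwaniecDispersion
import HarnessLib

/-!
# Bombieri–Friedlander–Iwaniec 1986, §§15, 17: glue between the sifted sums and the dispersion sums

Trunk `AntSieve`, companion to `…BombieriFriedlanderIwaniecDecomposition` (Heath-Brown's identity
applied to `E_z`, the functional `sievedDisc`, `roughRestrict`) and `…BombieriFriedlanderIwaniecDispersion`
(the sums `𝒟`, `𝒢`, the coefficients `roughIndicator`, Theorems 1, 2, 5, 5*).  Everything here is
PROVED; these are the bookkeeping identities used when a Heath-Brown piece, grouped as `α ⋆ β`, is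
fed into Theorems 1, 2, 5* with the factorisation `λ = λ₁ ⋆ λ₂` of the well-factorable weight
(BFI §17, p. 249: "due to the well factorable weights `λ(q)` [the combinatorial arguments] are more
flexible. We apply Theorems 1 and 2 with `R = x^{−ε} N` and `Q ≤ x^{4/7−4ε} N^{−1}`").

## Contents

* `roughRestrict_apply_eq_roughIndicator_mul` — `(F♭)(n) = 1_{(n,P(z))=1} · F(n)`: the restriction
  of `…Decomposition` is multiplication by the coefficient `roughIndicator` of (A₆*) in `…Dispersion`.
* `sievedDisc_eq_apDiscrepancy_sub` — `sievedDisc F q a z x` is the difference of the tree's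
  `apDiscrepancy` (Polymath's signed discrepancy, `LevelOfDistribution.lean`) of `n ↦ 1_rough(n) F(n)`
  at `⌊2x⌋` and at `⌊x⌋`; and `sievedDisc_eq_apDiscrepancy` when `F` vanishes on `[1, x]`.
* `IsWellFactorable.sum_mul_eq_sum_sum` — **the well-factorable split**: for `λ` well factorable of
  level `D = D₁ D₂` (`D₁, D₂ ≥ 1`) and ANY `G`,
  `∑_{d ≤ D} λ(d) G(d) = ∑_{q ≤ D₁} ∑_{r ≤ D₂} λ₁(q) λ₂(r) G(qr)` with `|λᵢ| ≤ 1` supported on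
  `[1, Dᵢ]` (the factorisation of BFI's definition, §1 p. 208; moduli `d = qr`).
* `sum_Icc_eq_sum_range_sum_dyadic` — the partition of `1 ≤ m ≤ N` into the dyadic blocks
  `m ∼ N/2^{k+1}` (`BFI.dyadic`), `k < K`, once `2^K > N` ("by an obvious partition of the range of
  summation", cf. p. 244).
* `apDiscrepancy_mul_eq_of_support` — **complete sums of a grouped piece are the brackets of `𝒟`**:
  for `α` supported in `m ∼ M`, `β` in `n ∼ N` and `4MN ≤ X`,
  `Δ(α ⋆ β; X, d, a) = ∑_{m∼M, n∼N, mn≡a (d)} α_m β_n − φ(d)⁻¹ ∑_{m∼M, n∼N, (mn,d)=1} α_m β_n`, the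
  bracket of BFI (3.1) at the modulus `d = qr`; with `roughIndicator_mul_mul_roughRestrict`
  (a convolution of rough-restricted factors is supported on rough integers).

## References

* E. Bombieri, J. B. Friedlander, H. Iwaniec, *Primes in arithmetic progressions to large moduli*,
  Acta Math. 156 (1986), 203–251, §1 Definition p. 208, §15 pp. 244–246, §17 p. 249.
  [BombieriFriedlanderIwaniecActa1986]
-/

open Finset Real

namespace Literature.NumberTheory.Sieve

namespace BFI

/-! ### `roughRestrict` versus `roughIndicator` -/

/-- The predicate `IsRough z` (…Dyadic) is the condition inside `roughIndicator z` (…Dispersion).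
[folklore] -/
theorem roughIndicator_eq_ite (z : ℝ) (n : ℕ) :
    roughIndicator z n = if IsRough z n then 1 else 0 := rfl

/-- `(F♭)(n) = 1_{(n,P(z))=1} F(n)`: the rough restriction of `…Decomposition` is multiplication by the
(A₆*) coefficient `roughIndicator` of `…Dispersion`. [folklore] -/
theorem roughRestrict_apply_eq_roughIndicator_mul (z : ℝ) (F : ArithmeticFunction ℝ) (n : ℕ) :
    roughRestrict z F n = roughIndicator z n * F n := by
  rw [roughRestrict_apply, roughIndicator_eq_ite]
  split_ifs <;> simp

/-! ### `sievedDisc` versus `apDiscrepancy` -/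

/-- A sum over `(x, 2x]` is the difference of the sums over `[1, 2x]` and `[1, x]` (`x ≥ 0`). [folklore] -/
theorem sum_Ioc_floor_eq_sub (f : ℕ → ℝ) {x : ℝ} (hx : 0 ≤ x) :
    ∑ n ∈ Ioc ⌊x⌋₊ ⌊2 * x⌋₊, f n = (∑ n ∈ Icc 1 ⌊2 * x⌋₊, f n) - ∑ n ∈ Icc 1 ⌊x⌋₊, f n := by
  have hle : ⌊x⌋₊ ≤ ⌊2 * x⌋₊ := Nat.floor_mono (by linarith)
  have h1 : Icc 1 ⌊2 * x⌋₊ = Ioc 0 ⌊2 * x⌋₊ := rfl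
  have h2 : Icc 1 ⌊x⌋₊ = Ioc 0 ⌊x⌋₊ := rfl
  rw [h1, h2, ← Finset.sum_Ioc_consecutive f (Nat.zero_le _) hle]
  ring

/-- `sievedDisc F q a z x = Δ(1_rough F; ⌊2x⌋, q, a) − Δ(1_rough F; ⌊x⌋, q, a)` with the tree's signed
discrepancy `apDiscrepancy` (`LevelOfDistribution.lean`), for `x ≥ 0`. [folklore] -/
theorem sievedDisc_eq_apDiscrepancy_sub (F : ℕ → ℝ) (q : ℕ) (a : ℤ) (z : ℝ) {x : ℝ} (hx : 0 ≤ x) :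
    sievedDisc F q a z x =
      apDiscrepancy (fun n => roughIndicator z n * F n) ⌊2 * x⌋₊ q (a : ZMod q) -
        apDiscrepancy (fun n => roughIndicator z n * F n) ⌊x⌋₊ q (a : ZMod q) := by
  have hA : ∀ (P : ℕ → Prop) [DecidablePred P] (N : ℕ),
      (∑ n ∈ (Icc 1 N).filter P, roughIndicator z n * F n) =
        ∑ n ∈ Icc 1 N, if IsRough z n ∧ P n then F n else 0 := by
    intro P _ N
    rw [Finset.sum_filter]
    refine Finset.sum_congr rfl fun n _ => ?_
    rw [roughIndicator_eq_ite]
    by_cases hr : IsRough z n <;> by_cases hp : P n <;> simp [hr, hp]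
  unfold sievedDisc apDiscrepancy
  rw [hA, hA, hA, hA, sum_Ioc_floor_eq_sub _ hx, sum_Ioc_floor_eq_sub _ hx]
  ring

/-- If `F` vanishes on `[1, x]` then `sievedDisc F q a z x = Δ(1_rough F; ⌊2x⌋, q, a)`; this is the
situation of an "interior" product of boxes in §15 (support inside `(x, 2x]`), for which the sifted
dyadic discrepancy is a complete sum. [folklore] -/
theorem sievedDisc_eq_apDiscrepancy {F : ℕ → ℝ} (q : ℕ) (a : ℤ) (z : ℝ) {x : ℝ} (hx : 0 ≤ x)
    (hF : ∀ n : ℕ, 1 ≤ n → (n : ℝ) ≤ x → F n = 0) :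
    sievedDisc F q a z x = apDiscrepancy (fun n => roughIndicator z n * F n) ⌊2 * x⌋₊ q (a : ZMod q) := by
  rw [sievedDisc_eq_apDiscrepancy_sub F q a z hx, sub_eq_self]
  unfold apDiscrepancy
  have hzero : ∀ n ∈ Icc 1 ⌊x⌋₊, roughIndicator z n * F n = 0 := by
    intro n hn
    rw [mem_Icc] at hn
    rw [hF n hn.1 ((Nat.cast_le.2 hn.2).trans (Nat.floor_le hx)), mul_zero]
  rw [Finset.sum_eq_zero fun n hn => hzero n (Finset.mem_filter.1 hn).1,
    Finset.sum_eq_zero fun n hn => hzero n (Finset.mem_filter.1 hn).1]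
  simp

/-! ### The well-factorable split of the moduli -/

/-- **The well-factorable split** (BFI §1 Definition, p. 208, as used in §17 p. 249): if `λ` is well
factorable of level `D = D₁ D₂` with `D₁, D₂ ≥ 1`, then there are `λ₁, λ₂` with `|λᵢ| ≤ 1`,
`λᵢ(n) = 0` for `n > Dᵢ`, such that for EVERY function `G`,
`∑_{1 ≤ d ≤ D} λ(d) G(d) = ∑_{1 ≤ q ≤ D₁} ∑_{1 ≤ r ≤ D₂} λ₁(q) λ₂(r) G(qr)`.
PROVED (the factorisation `λ = λ₁ ⋆ λ₂` and the expansion of a Dirichlet convolution,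
`sum_Ioc_mul_apply_mul`). [cite: BombieriFriedlanderIwaniecActa1986, §1 Definition p. 208; §17 p. 249] -/
theorem _root_.Literature.NumberTheory.Sieve.IsWellFactorable.sum_mul_eq_sum_sum {D : ℝ} {lam : ℕ → ℝ}
    (h : IsWellFactorable D lam) {D₁ D₂ : ℝ} (hD₁ : 1 ≤ D₁) (hD₂ : 1 ≤ D₂) (hD : D₁ * D₂ = D) :
    ∃ lam₁ lam₂ : ArithmeticFunction ℝ,
      (∀ n, |lam₁ n| ≤ 1) ∧ (∀ n, |lam₂ n| ≤ 1) ∧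
      (∀ n : ℕ, D₁ < n → lam₁ n = 0) ∧ (∀ n : ℕ, D₂ < n → lam₂ n = 0) ∧
      ∀ G : ℕ → ℝ, ∑ d ∈ Icc 1 ⌊D⌋₊, lam d * G d =
        ∑ q ∈ Icc 1 ⌊D₁⌋₊, ∑ r ∈ Icc 1 ⌊D₂⌋₊, lam₁ q * lam₂ r * G (q * r) := by
  obtain ⟨α, β, hα, hβ, hαs, hβs, hlam⟩ := h.exists_eq_mul hD₁ hD₂ hD
  refine ⟨α, β, hα, hβ, hαs, hβs, fun G => ?_⟩
  have hD0 : 0 ≤ D := by rw [← hD]; positivity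
  have hD₁0 : 0 ≤ D₁ := by linarith
  have hD₂0 : 0 ≤ D₂ := by linarith
  -- Step 1: expand `∑_{d ≤ D} (α ⋆ β)(d) G(d)` over pairs `q r ≤ ⌊D⌋`
  have h1 : ∑ d ∈ Icc 1 ⌊D⌋₊, lam d * G d =
      ∑ x ∈ (Ioc 0 ⌊D⌋₊ ×ˢ Ioc 0 ⌊D⌋₊).filter (fun x => x.1 * x.2 ≤ ⌊D⌋₊),
        α x.1 * β x.2 * G (x.1 * x.2) := by
    rw [← sum_Ioc_mul_apply_mul]
    exact Finset.sum_congr rfl fun d _ => by rw [hlam d]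
  rw [h1, ← Finset.sum_product']
  -- Step 2: both index sets carry the same nonzero terms
  symm
  apply Finset.sum_subset_zero_on_sdiff
  · -- pairs `q ≤ D₁`, `r ≤ D₂` have `q r ≤ D`
    intro x hx
    rw [Finset.mem_product, mem_Icc, mem_Icc] at hx
    obtain ⟨⟨hq1, hqD⟩, hr1, hrD⟩ := hx
    have hq : (x.1 : ℝ) ≤ D₁ := (Nat.cast_le.2 hqD).trans (Nat.floor_le hD₁0)
    have hr : (x.2 : ℝ) ≤ D₂ := (Nat.cast_le.2 hrD).trans (Nat.floor_le hD₂0)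
    have hqr : ((x.1 * x.2 : ℕ) : ℝ) ≤ D := by
      rw [← hD]; push_cast
      exact mul_le_mul hq hr (Nat.cast_nonneg _) hD₁0
    have hqrN : x.1 * x.2 ≤ ⌊D⌋₊ := Nat.le_floor hqr
    simp only [Finset.mem_filter, Finset.mem_product, mem_Ioc]
    refine ⟨⟨⟨hq1, ?_⟩, ⟨hr1, ?_⟩⟩, hqrN⟩
    · exact le_trans (Nat.le_mul_of_pos_right _ hr1) hqrN
    · exact le_trans (Nat.le_mul_of_pos_left _ hq1) hqrN
  · -- pairs outside `q ≤ D₁`, `r ≤ D₂` give zero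
    intro x hx
    rw [Finset.mem_sdiff, Finset.mem_filter, Finset.mem_product, mem_Ioc, mem_Ioc] at hx
    obtain ⟨⟨⟨⟨hq1, -⟩, hr1, -⟩, -⟩, hnot⟩ := hx
    rw [Finset.mem_product, mem_Icc, mem_Icc, not_and_or] at hnot
    rcases hnot with hq | hr
    · have : ⌊D₁⌋₊ < x.1 := by omega
      rw [hαs x.1 (Nat.lt_of_floor_lt this)]; ring
    · have : ⌊D₂⌋₊ < x.2 := by omega
      rw [hβs x.2 (Nat.lt_of_floor_lt this)]; ring
  · intro x _; rfl

/-! ### Dyadic partition of a range of moduli -/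

/-- The dyadic block below `N/2^k`: `{m : N/2^{k+1} < m ≤ N/2^k} = BFI.dyadic (N/2^{k+1})`, and
`1 ≤ m ≤ ⌊y⌋` splits as `1 ≤ m ≤ ⌊y/2⌋` plus the block `y/2 < m ≤ y` (`y ≥ 0`). [folklore] -/
theorem sum_Icc_floor_eq_add_sum_dyadic (f : ℕ → ℝ) {y : ℝ} (hy : 0 ≤ y) :
    ∑ m ∈ Icc 1 ⌊y⌋₊, f m = (∑ m ∈ Icc 1 ⌊y / 2⌋₊, f m) + ∑ m ∈ dyadic (y / 2), f m := by
  have hd : dyadic (y / 2) = Ioc ⌊y / 2⌋₊ ⌊y⌋₊ := by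
    ext m
    rw [mem_dyadic (by linarith), mem_Ioc]
    constructor
    · rintro ⟨h1, h2⟩
      refine ⟨(Nat.floor_lt (by linarith)).2 h1, Nat.le_floor ?_⟩
      linarith
    · rintro ⟨h1, h2⟩
      refine ⟨Nat.lt_of_floor_lt h1, ?_⟩
      have := (Nat.cast_le.2 h2).trans (Nat.floor_le hy)
      linarith
  have h1 : Icc 1 ⌊y⌋₊ = Ioc 0 ⌊y⌋₊ := rfl
  have h2 : Icc 1 ⌊y / 2⌋₊ = Ioc 0 ⌊y / 2⌋₊ := rfl
  rw [hd, h1, h2]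
  exact (Finset.sum_Ioc_consecutive f (Nat.zero_le _)
    (Nat.floor_mono (by linarith : y / 2 ≤ y))).symm

/-- **Dyadic partition of the moduli** ("an obvious partition of the range of summation"): for
`N ≥ 0` and `2^K > N`, `∑_{1 ≤ m ≤ N} f(m) = ∑_{k<K} ∑_{m ∼ N/2^{k+1}} f(m)` with BFI's dyadic blocks
`m ∼ M ⇔ M < m ≤ 2M`. [cite: BombieriFriedlanderIwaniecActa1986, §15 p. 244] -/
theorem sum_Icc_eq_sum_range_sum_dyadic (f : ℕ → ℝ) {N : ℝ} (hN : 0 ≤ N) {K : ℕ}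
    (hK : N < 2 ^ K) :
    ∑ m ∈ Icc 1 ⌊N⌋₊, f m = ∑ k ∈ range K, ∑ m ∈ dyadic (N / 2 ^ (k + 1)), f m := by
  -- telescope: `∑_{m ≤ N} = ∑_{m ≤ N/2^K} + ∑_{k<K} (block k)`, and `⌊N/2^K⌋ = 0`
  have htel : ∀ K : ℕ, ∑ m ∈ Icc 1 ⌊N⌋₊, f m =
      (∑ m ∈ Icc 1 ⌊N / 2 ^ K⌋₊, f m) + ∑ k ∈ range K, ∑ m ∈ dyadic (N / 2 ^ (k + 1)), f m := by
    intro K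
    induction K with
    | zero => simp
    | succ K ih =>
      rw [Finset.sum_range_succ, ih, ← add_assoc, add_right_comm,
        sum_Icc_floor_eq_add_sum_dyadic f (by positivity : 0 ≤ N / 2 ^ K)]
      congr 2
      · rw [pow_succ, div_div]
      · rw [pow_succ, div_div]
  rw [htel K]
  have h0 : ⌊N / 2 ^ K⌋₊ = 0 := by
    refine Nat.floor_eq_zero.2 ?_
    rw [div_lt_one (by positivity)]
    exact hK
  rw [h0]
  simp


/-! ### Complete sums of a grouped piece `α ⋆ β` are the brackets of `𝒟` -/

/-- A convolution of two rough-restricted functions vanishes off the `z`-rough integers (a prime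
`p < z` dividing `n = de` divides `d` or `e`). [folklore] -/
theorem roughRestrict_mul_roughRestrict_apply_of_not {z : ℝ} (F G : ArithmeticFunction ℝ) {n : ℕ}
    (hn : ¬IsRough z n) : (roughRestrict z F * roughRestrict z G) n = 0 := by
  rw [ArithmeticFunction.mul_apply]
  refine Finset.sum_eq_zero fun p hp => ?_
  rw [Nat.mem_divisorsAntidiagonal] at hp
  obtain ⟨hpn, hn0⟩ := hp
  -- a small prime factor of `n` divides `p.1` or `p.2`
  have h10 : p.1 ≠ 0 := fun h0 => hn0 (by rw [← hpn, h0, zero_mul])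
  have h20 : p.2 ≠ 0 := fun h0 => hn0 (by rw [← hpn, h0, mul_zero])
  have : ¬(IsRough z p.1 ∧ IsRough z p.2) := by
    intro ⟨h1, h2⟩
    apply hn
    intro r hr
    have hrn : r ∈ (p.1 * p.2).primeFactors := by rwa [hpn]
    rw [Nat.primeFactors_mul h10 h20] at hrn
    rcases Finset.mem_union.1 hrn with h | h
    · exact h1 r h
    · exact h2 r h
  rw [roughRestrict_apply, roughRestrict_apply]
  by_cases h1 : IsRough z p.1
  · have h2 : ¬IsRough z p.2 := fun h2 => this ⟨h1, h2⟩
    rw [if_neg h2, mul_zero]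
  · rw [if_neg h1, zero_mul]

/-- Hence `(F♭ ⋆ G♭)` is its own rough restriction: `1_rough · (F♭ ⋆ G♭) = F♭ ⋆ G♭` pointwise.
[folklore] -/
theorem roughIndicator_mul_mul_roughRestrict (z : ℝ) (F G : ArithmeticFunction ℝ) (n : ℕ) :
    roughIndicator z n * (roughRestrict z F * roughRestrict z G) n =
      (roughRestrict z F * roughRestrict z G) n := by
  rw [roughIndicator_eq_ite]
  split_ifs with h
  · rw [one_mul]
  · rw [roughRestrict_mul_roughRestrict_apply_of_not F G h, mul_zero]

/-- **Complete sums of `α ⋆ β` are the brackets of `𝒟`.**  If `α` is supported in `m ∼ M` and `β` in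
`n ∼ N` (`M, N ≥ 1/2`) and `4MN ≤ X`, then for every modulus `d` and residue `a`, the tree's signed
discrepancy of `α ⋆ β` up to `X` is the bracket of BFI's (3.1):
`Δ(α ⋆ β; X, d, a) = ∑_{m∼M} ∑_{n∼N, mn ≡ a (d)} α_m β_n − φ(d)⁻¹ ∑_{m∼M} ∑_{n∼N, (mn,d)=1} α_m β_n`.
PROVED (`sum_Ioc_mul_apply_mul` and the supports). [cite: BombieriFriedlanderIwaniecActa1986, §3 (3.1) p. 214] -/
theorem apDiscrepancy_mul_eq_of_support {α β : ArithmeticFunction ℝ} {M N : ℝ} (hM : 1 / 2 ≤ M)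
    (hN : 1 / 2 ≤ N) (hα : ∀ m : ℕ, m ∉ dyadic M → α m = 0) (hβ : ∀ n : ℕ, n ∉ dyadic N → β n = 0)
    {X : ℕ} (hX : 4 * M * N ≤ X) (d : ℕ) (a : ZMod d) :
    apDiscrepancy (fun n => (α * β) n) X d a =
      (∑ m ∈ dyadic M, ∑ n ∈ dyadic N, if ((m * n : ℕ) : ZMod d) = a then α m * β n else 0) -
        (∑ m ∈ dyadic M, ∑ n ∈ dyadic N, if (m * n).Coprime d then α m * β n else 0) /
          (Nat.totient d : ℝ) := by
  have hM0 : 0 ≤ M := by linarith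
  have hN0 : 0 ≤ N := by linarith
  -- the generic step: a filtered sum of `α ⋆ β` over `[1, X]` as a double sum over the supports
  have key : ∀ (P : ℕ → Prop) [DecidablePred P],
      (∑ n ∈ (Icc 1 X).filter P, (α * β) n) =
        ∑ m ∈ dyadic M, ∑ n ∈ dyadic N, if P (m * n) then α m * β n else 0 := by
    intro P _
    have h1 : (∑ n ∈ (Icc 1 X).filter P, (α * β) n) =
        ∑ n ∈ Ioc 0 X, (α * β) n * (if P n then 1 else 0) := by
      rw [Finset.sum_filter]
      exact Finset.sum_congr rfl fun n _ => by split_ifs <;> simp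
    rw [h1, sum_Ioc_mul_apply_mul, ← Finset.sum_product']
    -- compare the two index sets
    symm
    apply Finset.sum_subset_zero_on_sdiff
    · intro x hx
      rw [Finset.mem_product] at hx
      obtain ⟨h1, h2⟩ := (mem_dyadic hM0).1 hx.1
      obtain ⟨h3, h4⟩ := (mem_dyadic hN0).1 hx.2
      have hm1 : 1 ≤ x.1 := pos_of_mem_dyadic hM0 hx.1
      have hn1 : 1 ≤ x.2 := pos_of_mem_dyadic hN0 hx.2
      have hmn : ((x.1 * x.2 : ℕ) : ℝ) ≤ X := by
        push_cast
        calc (x.1 : ℝ) * x.2 ≤ (2 * M) * (2 * N) :=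
              mul_le_mul h2 h4 (Nat.cast_nonneg _) (by linarith)
          _ = 4 * M * N := by ring
          _ ≤ X := hX
      have hmnX : x.1 * x.2 ≤ X := by exact_mod_cast hmn
      simp only [Finset.mem_filter, Finset.mem_product, mem_Ioc]
      exact ⟨⟨⟨hm1, le_trans (Nat.le_mul_of_pos_right _ hn1) hmnX⟩,
        ⟨hn1, le_trans (Nat.le_mul_of_pos_left _ hm1) hmnX⟩⟩, hmnX⟩
    · intro x hx
      rw [Finset.mem_sdiff, Finset.mem_product, not_and_or] at hx
      rcases hx.2 with h | h
      · rw [hα _ h]; simp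
      · rw [hβ _ h]; simp
    · intro x _
      split_ifs <;> simp
  unfold apDiscrepancy
  rw [key, key]

end BFI

end Literature.NumberTheory.Sieve
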